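import Mathlib
import HarnessLib
import Summits.ResolutionOfSingularities.ResolutionOfSingularities.Theorems.WildQuotientsWildQuotientResolutionS1aQhRoot

/-!
# S1a — THE QUASI-HOMOGENEOUS ROOT OF THE R4 NORMAL FORM over an ABSTRACT node ring (localised bases, multi-support roots)

[OURS · L1 W4.5c · lead-1 g16; plan-1 RULING R-F15o (3) design (α1) «k-RATIONAL multi-support … the existing polynomial free models serve as node data on these
basic opens»: the ring level of ✓`…S1aQhRoot` restated for an ARBITRARY commutative ring `L` with a centre `f : Fin 3 → L`, a tail variable `x₃`, a τ-fixed generating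
set `Gfix` and the R4 rows — so that BOTH the polynomial datum (`L = A ≃ k[x]`, `Gfix` = constants) and its LOCALISATIONS `L = k[x][1/h]` (`Gfix` ∋ `1/h`; the node of
an invariant basic open `D(h)` carrying one point of a multi-support root) are instances; pattern ✓`…S1aA1Move3Ring` (abstract node ring with rows)] — NOT statements of
the manuscript; counted 0; AI-level work, weaker than expert review. Crux stmt-ResolutionOfSingularities-17941 `CyclicQuotientFourfolds`, line `s1a-logminvertex` v13
(`stub_reachLowerInFX`).

Datum: `τ (f 0) = f 0`, `τ (f 1) = f 1 + f 0`, `τ (f 2) = f 2`, `τ x₃ = x₃ + t`, `t ∈ 𝒥_sh(f; w)`, `w 0 = w 1 + sh`, `τ` fixes `Gfix`, `Subring.closure (range f ∪ {x₃} ∪ Gfix) = ⊤`.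
* `qha_admissible_one` / `qha_admissible` / `qha_map_le` ((a′)_sh and σ-adaptedness); `qha_augmentationIdeal_sigmaR_le` ((H1) `aug σ_R ≤ (s^sh)`);
* rows in `R^w`: `qha_sigmaR_u'_zero`, `qha_sigmaR_u'_one_sub` (`σ_R u₁′ − u₁′ = s^sh u₀′`), `qha_sigmaR_u'_two`, `qha_sigmaR_algebraMap_three_sub` (`σ_R x₃ − x₃ = s^sh t̂`);
* residual: `qha_u'_zero_mem_residual`, `qha_tail_mem_residual`.
-/

set_option linter.dupNamespace false

noncomputable section

open Literature.AlgebraicGeometry.Resolution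
open scoped LaurentPolynomial
open Summit.ResolutionOfSingularities.ResolutionOfSingularities.Theorems.WildQuotientResolution.S1.CoarseChart
open Summit.ResolutionOfSingularities.ResolutionOfSingularities.Theorems.WildQuotientResolution.S1.GameFrame.GModel

namespace Summit.ResolutionOfSingularities.ResolutionOfSingularities.Theorems.WildQuotientResolution.S1.KillCert.QhAbs

variable {L : Type} [CommRing L] (τ : L ≃+* L) (f : Fin 3 → L) (x₃ t : L) (w : Fin 3 → ℕ) (sh : ℕ) (Gfix : Set L)
  (h0 : τ (f 0) = f 0) (h1 : τ (f 1) = f 1 + f 0) (h2 : τ (f 2) = f 2) (h3 : τ x₃ = x₃ + t)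
  (hfix : ∀ g ∈ Gfix, τ g = g) (hgen : Subring.closure (Set.range f ∪ {x₃} ∪ Gfix) = ⊤)
  (hw0 : w 0 = w 1 + sh) (ht : t ∈ (weightedFiltration f w).ideal sh)

/-! ## (a′)_sh -/

include h0 h1 h2 h3 hfix hgen hw0 ht in
/-- **(a′)_sh over an abstract node ring**, `β = 1` product form: `y ∈ 𝒥ₙ ⇒ τy − y ∈ (1)·𝒥ₙ₊sh`. [OURS · L1 W4.5c · R4 root, abstract] -/
theorem qha_admissible_one (n : ℕ) (y : L) (hy : y ∈ (weightedFiltration f w).ideal n) :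
    τ y - y ∈ Ideal.span {(1 : L)} * (weightedFiltration f w).ideal (n + sh) := by
  have hX0 : f 0 ∈ (weightedFiltration f w).ideal (w 0) := mem_weightedFiltration_ideal f w 0
  have h1J : ∀ {m : ℕ} {z : L}, z ∈ (weightedFiltration f w).ideal m → z ∈ Ideal.span {(1 : L)} * (weightedFiltration f w).ideal m :=
    fun hz => by rw [Ideal.span_singleton_one, Ideal.top_mul]; exact hz
  refine admissible_shift_of_generators f w τ sh 1 _ hgen ?_ ?_ n y hy
  · rintro g ((⟨i, rfl⟩ | hg) | hg)
    · refine h1J ?_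
      fin_cases i
      · change τ (f 0) - f 0 ∈ _; rw [h0, sub_self]; exact Ideal.zero_mem _
      · change τ (f 1) - f 1 ∈ _; rw [h1, add_sub_cancel_left]; exact (weightedFiltration _ _).antitone (by omega) hX0
      · change τ (f 2) - f 2 ∈ _; rw [h2, sub_self]; exact Ideal.zero_mem _
    · rw [Set.mem_singleton_iff.mp hg, h3, add_sub_cancel_left]; exact h1J ht
    · rw [hfix g hg, sub_self]; exact Ideal.zero_mem _
  · intro i
    refine h1J ?_
    fin_cases i
    · change τ (f 0) - f 0 ∈ _; rw [h0, sub_self]; exact Ideal.zero_mem _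
    · change τ (f 1) - f 1 ∈ (weightedFiltration f w).ideal (w 1 + sh)
      rw [h1, add_sub_cancel_left, ← hw0]; exact hX0
    · change τ (f 2) - f 2 ∈ _; rw [h2, sub_self]; exact Ideal.zero_mem _

include h0 h1 h2 h3 hfix hgen hw0 ht in
/-- **(a′)_sh**: `y ∈ 𝒥ₙ ⇒ τy − y ∈ 𝒥ₙ₊sh`. -/
theorem qha_admissible (n : ℕ) (y : L) (hy : y ∈ (weightedFiltration f w).ideal n) : τ y - y ∈ (weightedFiltration f w).ideal (n + sh) := by
  have h := qha_admissible_one τ f x₃ t w sh Gfix h0 h1 h2 h3 hfix hgen hw0 ht n y hy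
  rwa [Ideal.span_singleton_one, Ideal.top_mul] at h

include h0 h1 h2 h3 hfix hgen hw0 ht in
/-- σ-adaptedness of the centre, degree by degree. -/
theorem qha_map_le (n : ℕ) : ((weightedFiltration f w).ideal n).map (τ : L →+* L) ≤ (weightedFiltration f w).ideal n :=
  map_le_of_admissible_shift _ _ τ sh 1 (qha_admissible_one τ f x₃ t w sh Gfix h0 h1 h2 h3 hfix hgen hw0 ht) n

/-! ## (H1), the rows in `R^w` and the residual ideal `𝔞 = (aug σ_R : s^sh)` -/

section Residual

variable {p : ℕ} (hp : 0 < p) (hσp : ∀ x : L, (⇑τ)^[p] x = x)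
  (hσJ : ∀ n : ℕ, ((weightedFiltration f w).ideal n).map (τ : L →+* L) ≤ (weightedFiltration f w).ideal n)

include h0 h1 h2 h3 hfix hgen hw0 ht in
/-- **(H1)**: every increment `σ_R z − z` is a multiple of `s^sh`. [OURS · L1 W4.5c · R4 root, abstract] -/
theorem qha_augmentationIdeal_sigmaR_le : augmentationIdeal (sigmaR τ f w hσJ hp hσp) ≤ Ideal.span {cobordantAlgebra.s f w ^ sh} := by
  have h := augmentationIdeal_sigmaR_le_span_of_admissible_shift f w τ hσJ hp hσp sh 1 (qha_admissible_one τ f x₃ t w sh Gfix h0 h1 h2 h3 hfix hgen hw0 ht)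
  rwa [map_one, one_mul] at h

include h0 in
/-- `σ_R u₀′ = u₀′`. -/
theorem qha_sigmaR_u'_zero : sigmaR τ f w hσJ hp hσp (cobordantAlgebra.u' f w 0) = cobordantAlgebra.u' f w 0 := by
  have hu0 : cobordantAlgebra.u' f w 0 = ⟨LaurentPolynomial.C (f 0) * LaurentPolynomial.T ((w 0 : ℕ) : ℤ), (cobordantAlgebra.u' f w 0).2⟩ := rfl
  rw [hu0, sigmaR_mk]
  exact Subtype.ext (by change LaurentPolynomial.C (τ (f 0)) * _ = LaurentPolynomial.C (f 0) * _; rw [h0])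

include h2 in
/-- `σ_R u₂′ = u₂′` (the invariant generator). -/
theorem qha_sigmaR_u'_two : sigmaR τ f w hσJ hp hσp (cobordantAlgebra.u' f w 2) = cobordantAlgebra.u' f w 2 := by
  have hu2 : cobordantAlgebra.u' f w 2 = ⟨LaurentPolynomial.C (f 2) * LaurentPolynomial.T ((w 2 : ℕ) : ℤ), (cobordantAlgebra.u' f w 2).2⟩ := rfl
  rw [hu2, sigmaR_mk]
  exact Subtype.ext (by change LaurentPolynomial.C (τ (f 2)) * _ = LaurentPolynomial.C (f 2) * _; rw [h2])

include h1 hw0 in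
/-- `σ_R u₁′ − u₁′ = s^sh · u₀′`. -/
theorem qha_sigmaR_u'_one_sub :
    sigmaR τ f w hσJ hp hσp (cobordantAlgebra.u' f w 1) - cobordantAlgebra.u' f w 1 = cobordantAlgebra.s f w ^ sh * cobordantAlgebra.u' f w 0 := by
  have hyj : τ (f 1) - f 1 = 1 * f 0 := by rw [h1]; ring
  have h := sigmaR_sub_eq_of_admissible_shift f w τ hσJ hp hσp sh 1 (n := w 1) hyj (cobordantAlgebra.u' f w 1) (cobordantAlgebra.u' f w 0)
    (by rw [cobordantAlgebra.coe_u']) (by rw [cobordantAlgebra.coe_u', hw0])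
  rw [h, map_one, one_mul]

include h1 hw0 in
/-- ★ `u₀′ ∈ 𝔞 := (augIdeal σ_R : s^sh)`: the `[f 0]`-chart is KILLED. -/
theorem qha_u'_zero_mem_residual :
    cobordantAlgebra.u' f w 0 ∈ (augmentationIdeal (sigmaR τ f w hσJ hp hσp)).colon (Ideal.span {cobordantAlgebra.s f w ^ sh}) := by
  rw [Ideal.mem_colon_span_singleton, mul_comm, ← qha_sigmaR_u'_one_sub τ f w sh h1 hw0 hp hσp hσJ]
  exact sub_mem_augmentationIdeal _ _

include h3 in
/-- `σ_R x₃ − x₃ = s^sh · t̂`, `t̂ = t·T^sh`. -/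
theorem qha_sigmaR_algebraMap_three_sub :
    sigmaR τ f w hσJ hp hσp (algebraMap L _ x₃) - algebraMap L _ x₃ = cobordantAlgebra.s f w ^ sh * ⟨_, C_mul_T_mem_cobordantAlgebra _ _ ht⟩ := by
  have hyj : τ x₃ - x₃ = 1 * t := by rw [h3]; ring
  have h := sigmaR_sub_eq_of_admissible_shift f w τ hσJ hp hσp sh 1 (n := 0) hyj (algebraMap L _ x₃) ⟨_, C_mul_T_mem_cobordantAlgebra _ _ ht⟩
    (by rw [cobordantAlgebra.coe_algebraMap, Nat.cast_zero, LaurentPolynomial.T_zero, mul_one]) (by rw [Nat.zero_add])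
  rw [h, map_one, one_mul]

include h3 in
/-- ★ `t̂ ∈ 𝔞 = (aug σ_R : s^sh)`. -/
theorem qha_tail_mem_residual :
    (⟨_, C_mul_T_mem_cobordantAlgebra _ _ ht⟩ : ↥(cobordantAlgebra f w)) ∈ (augmentationIdeal (sigmaR τ f w hσJ hp hσp)).colon (Ideal.span {cobordantAlgebra.s f w ^ sh}) := by
  rw [Ideal.mem_colon_span_singleton, mul_comm, ← qha_sigmaR_algebraMap_three_sub τ f x₃ t w sh h3 ht hp hσp hσJ]
  exact sub_mem_augmentationIdeal _ _

end Residual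

/-! ## The polynomial datum is an instance (sanity check of the generating set) -/

/-- For `e : A ≃ k[x₀..x₃]` the family `e⁻¹(x₀,x₁,x₂)`, the variable `e⁻¹x₃` and the constants `e⁻¹(C a)` generate `A`. -/
theorem closure_poly_eq_top {k : Type} [Field k] {A : Type} [CommRing A] (e : A ≃+* MvPolynomial (Fin 4) k) :
    Subring.closure (Set.range (e.symm ∘ ![MvPolynomial.X 0, MvPolynomial.X 1, MvPolynomial.X 2] : Fin 3 → A) ∪ {e.symm (MvPolynomial.X 3)} ∪
      Set.range (fun a : k => e.symm (MvPolynomial.C a))) = ⊤ := by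
  have hgen : Subring.closure (e.symm '' (Set.range (MvPolynomial.C : k → MvPolynomial (Fin 4) k) ∪ Set.range (MvPolynomial.X : Fin 4 → MvPolynomial (Fin 4) k))) = ⊤ := by
    show Subring.closure ((e.symm : MvPolynomial (Fin 4) k →+* A) '' _) = ⊤
    rw [← RingHom.map_closure, KillCert.closure_range_C_union_range_X_of k (Fin 4), ← RingHom.range_eq_map]
    exact RingHom.range_eq_top.mpr e.symm.surjective
  rw [eq_top_iff, ← hgen, Subring.closure_le]
  rintro _ ⟨g, hg | ⟨i, rfl⟩, rfl⟩
  · obtain ⟨a, rfl⟩ := hg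
    exact Subring.subset_closure (Or.inr ⟨a, rfl⟩)
  · fin_cases i
    · exact Subring.subset_closure (Or.inl (Or.inl ⟨0, rfl⟩))
    · exact Subring.subset_closure (Or.inl (Or.inl ⟨1, rfl⟩))
    · exact Subring.subset_closure (Or.inl (Or.inl ⟨2, rfl⟩))
    · exact Subring.subset_closure (Or.inl (Or.inr rfl))

end Summit.ResolutionOfSingularities.ResolutionOfSingularities.Theorems.WildQuotientResolution.S1.KillCert.QhAbs

end
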